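import Summits.SmoothPoincare4.SmoothPoincare4.Theorems.CongruenceShadowsAgkCor6SufficiencyStubSeamFormZone

/-!
# Helpers for stub `stub_seamForm` of line `lp-by-sphere-system-surgery` (crux `AgkCor6Sufficiency`,
item stmt-SmoothPoincare4-10894, routes CongruenceShadows / GroupTrisection; lead reshape r5, A3):
the seam cutoff `χ m`

Given the seam zone `N` of seam `m` (`exists_seamZone`, `…StubSeamFormZone.lean`) we build the
**seam cutoff** `χ = 𝟙_N · θ · ψ(σ)` of the seam normalisation `G_norm + χ (1 - σ - G_norm)`
(`exists_seamCutoff`, bundled in the registered helper stub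
`stub_seamFormCutoffToolkit : SeamFormCutoffToolkit`): `θ = seamTaper r₀ (p)` on the tube
`T(10 r₀)` and `1` beyond, `ψ` the log-slow plateau of `exists_sqProfile` at a scale `δ` below
`r₀⁴ / 16` and below the (positive) minimum of `σ²` on the compact part of the frontier of `N`
off `T(10 r₀)`, with slowness `η` below the threshold of the zone.  Then `χ` is smooth (it
vanishes near every point off `N`), `χ = seamTaper r₀ (p)` on the thin box, `χ = 0` on `T(4 r₀)`,
`χ = 1` along the seam beyond `T(9 r₀)`, and NO function agreeing near a point of `N` with
`G_norm + χ(1 - σ - G_norm)` is critical there (`modified_regular_tube` in the box, the local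
estimate of the zone outside).

## References

* A. Abrams, D. Gay, R. Kirby, *Group trisections and smooth 4-manifolds*, Geom. Topol. 22
  (2018), proof of Thm. 5. [AbramsGayKirby2018]
-/

noncomputable section

-- the prescribed namespace `Summit.<P>.<Sub>.…` duplicates `SmoothPoincare4` (P = Sub)
set_option linter.dupNamespace false

open Set Function Filter Metric
open scoped Manifold ContDiff Topology

namespace Summit.SmoothPoincare4.SmoothPoincare4.Cruxes.AgkCor6Sufficiency.LpBySphereSystemSurgery

open Literature.Topology.FourManifolds

variable {X : Type} [TopologicalSpace X] [ChartedSpace (EuclideanSpace ℝ (Fin 4)) X]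

/-- The seam coordinate `p` is a smooth function of the point. -/
theorem contMDiff_pCo_comp (m : Fin 3) {u v : X → ℝ} (hu : ContMDiff (𝓡 4) 𝓘(ℝ, ℝ) ∞ u)
    (hv : ContMDiff (𝓡 4) 𝓘(ℝ, ℝ) ∞ v) : ContMDiff (𝓡 4) 𝓘(ℝ, ℝ) ∞ fun x => pCo m (u x) (v x) := by
  fin_cases m
  · show ContMDiff (𝓡 4) 𝓘(ℝ, ℝ) ∞ fun x => -u x
    exact hu.neg
  · exact hu
  · exact hv

/-- **The seam cutoff** (see the module docstring). [cite: AbramsGayKirby2018, proof of Thm. 5] -/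
theorem exists_seamCutoff [T2Space X] [IsManifold (𝓡 4) ∞ X] [CompactSpace X]
    {S : Fin 3 → Set X} {u v : X → ℝ} {ρ : X → X} {U O : Set X} {c : Fin 3 → ℕ → ℕ}
    (hT : TriNormalForm S 0 1 2 u v ρ U O c) {G : Fin 3 → X → ℝ}
    (hGs : ∀ j, ContMDiff (𝓡 4) 𝓘(ℝ, ℝ) ∞ (G j))
    (hG1 : ∀ j, ∀ p ∈ S j, p ∉ interior (S j) → G j p = 1)
    (hG2 : ∀ j, ∀ p ∈ interior (S j), G j p < 1)
    (hG3 : ∀ j, ∀ p ∈ S j, p ∉ interior (S j) → p ∉ (⋂ l, S l) →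
      ¬ IsMCriticalPt (𝓡 4) (G j) p)
    (hhalf : ∀ j, ∀ p ∈ S j, p ∉ (⋂ l, S l) →
      ∃ D : HalfSliceChart (𝓡 4) (S j), p ∈ D.Θ.source ∧ ∀ q ∈ D.Θ.source, q ∉ ⋂ l, S l)
    {Ot : Set X} {rt : ℝ} {tp : X → ℝ → ℝ → X}
    (hTS : TubeStructure (S 0) (⋂ l, S l) u v ρ O Ot rt tp) {r₀ : ℝ} (hr₀ : 0 < r₀)
    (hrt : 20 * r₀ ≤ rt)
    (hunit : ∀ j, ∀ x ∈ tubeSet Ot u v (20 * r₀), G j x = unitForm j (u x) (v x))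
    (m : Fin 3) {Um : Set X} (hUmo : IsOpen Um)
    (hUm : ∀ x ∈ S (refIdx m) ∩ S (normIdx m), x ∉ tubeSet Ot u v (9 * r₀) → x ∈ Um) :
    ∃ (N : Set X) (χ : X → ℝ) (e : ℝ), IsOpen N ∧ 0 < e ∧
      (∀ x ∈ S (refIdx m) ∩ S (normIdx m), x ∉ tubeSet Ot u v (2 * r₀) → x ∈ N) ∧
      (∀ x ∈ tubeSet Ot u v (10 * r₀),
        x ∈ N ↔ r₀ < pCo m (u x) (v x) ∧ |qCo m (u x) (v x)| < r₀ / 2) ∧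
      N ⊆ tubeSet Ot u v (10 * r₀) ∪ Um ∧
      (∀ x ∈ N, ¬ IsMCriticalPt (𝓡 4) (G (refIdx m)) x) ∧
      (∀ x ∈ N, ¬ IsMCriticalPt (𝓡 4) (G (normIdx m)) x) ∧
      (∀ x ∈ N, G (refIdx m) x = 1 ↔ x ∈ S (refIdx m) ∩ S (normIdx m)) ∧
      (∀ x ∈ N, x ∈ S (refIdx m) ↔ G (refIdx m) x ≤ 1) ∧
      (∀ x ∈ N, x ∈ S (normIdx m) ↔ 1 ≤ G (refIdx m) x) ∧
      ContMDiff (𝓡 4) 𝓘(ℝ, ℝ) ∞ χ ∧ (∀ x, 0 ≤ χ x ∧ χ x ≤ 1) ∧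
      (∀ x ∉ N, χ =ᶠ[𝓝 x] fun _ => 0) ∧
      (∀ x ∈ tubeSet Ot u v (10 * r₀), r₀ < pCo m (u x) (v x) → |G (refIdx m) x - 1| < e →
        x ∈ N ∧ χ x = seamTaper r₀ (pCo m (u x) (v x))) ∧
      (∀ x ∈ tubeSet Ot u v (4 * r₀), χ x = 0) ∧
      (∀ x ∈ N, x ∉ tubeSet Ot u v (9 * r₀) → |G (refIdx m) x - 1| < e → χ x = 1) ∧
      (∀ x ∈ N, ∀ f : X → ℝ, ContMDiff (𝓡 4) 𝓘(ℝ, ℝ) ∞ f →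
        (f =ᶠ[𝓝 x] fun y => G (normIdx m) y + χ y * (1 - (G (refIdx m) y - 1) - G (normIdx m) y)) →
        ¬ IsMCriticalPt (𝓡 4) f x) := by
  classical
  obtain ⟨N, η₀, hNo, hη₀, hP2, hP3, hP4, hP5, hP5n, hP6, hP7, hP8, hA1, hA2, hA3, hLM⟩ :=
    exists_seamZone hT hGs hG1 hG2 hG3 hhalf hTS hr₀ hrt hunit m hUmo hUm
  -- ### basic facts
  have hfr := hT.frame
  have hu : Continuous u := hfr.contMDiff_u.continuous
  have hv : Continuous v := hfr.contMDiff_v.continuous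
  have hpc := continuous_pCo_comp m hu hv
  have hρF : ∀ x ∈ Ot, ρ x ∈ ⋂ l, S l := fun x hx => hfr.ρ_mem x (hTS.subset_O hx)
  have hTo : ∀ s, IsOpen (tubeSet Ot u v s) := isOpen_tubeSet hTS hfr
  have h10_20 : tubeSet Ot u v (10 * r₀) ⊆ tubeSet Ot u v (20 * r₀) :=
    tubeSet_mono (by linarith) (by linarith)
  have h4_10 : tubeSet Ot u v (4 * r₀) ⊆ tubeSet Ot u v (10 * r₀) :=
    tubeSet_mono (by linarith) (by linarith)
  have h9_10 : tubeSet Ot u v (9 * r₀) ⊆ tubeSet Ot u v (10 * r₀) :=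
    tubeSet_mono (by linarith) (by linarith)
  have hσ20 : ∀ x ∈ tubeSet Ot u v (20 * r₀),
      G (refIdx m) x - 1 = -2 * pCo m (u x) (v x) * qCo m (u x) (v x) := fun x hx => by
    rw [hunit _ x hx]; exact unitForm_refIdx m (u x) (v x)
  have hGn20 : ∀ x ∈ tubeSet Ot u v (20 * r₀), G (normIdx m) x =
      1 + 2 * pCo m (u x) (v x) * qCo m (u x) (v x) - 2 * qCo m (u x) (v x) ^ 2 := fun x hx => by
    rw [hunit _ x hx]; exact unitForm_normIdx m (u x) (v x)
  have hp_lt : ∀ {x : X} {s : ℝ}, 0 < s → x ∈ tubeSet Ot u v s → pCo m (u x) (v x) < s := by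
    intro x s hs hx
    have h1 := pCo_sq_le m (u x) (v x)
    have h2 : pCo m (u x) (v x) ^ 2 < s ^ 2 := lt_of_le_of_lt h1 hx.2
    exact (abs_lt.1 (abs_lt_of_sq_lt_sq h2 hs.le)).2
  -- ### the frontier bound `μ`
  set Z : Set X := closure N ∩ (Nᶜ ∩ (tubeSet Ot u v (10 * r₀))ᶜ) with hZ
  have hZc : IsCompact Z :=
    (isClosed_closure.inter ((hNo.isClosed_compl).inter (hTo _).isClosed_compl)).isCompact
  have hZne : ∀ x ∈ Z, G (refIdx m) x - 1 ≠ 0 := fun x hx h =>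
    hA2 x hx.1 hx.2.1 hx.2.2 (by linarith)
  obtain ⟨μ, hμ, hμle⟩ : ∃ μ : ℝ, 0 < μ ∧ ∀ x ∈ Z, μ ≤ |G (refIdx m) x - 1| := by
    rcases Z.eq_empty_or_nonempty with hZe | hZe
    · exact ⟨1, one_pos, fun x hx => by rw [hZe] at hx; exact absurd hx (notMem_empty _)⟩
    · have hcont : ContinuousOn (fun x => |G (refIdx m) x - 1|) Z :=
        (((hGs _).continuous.sub continuous_const).abs).continuousOn
      obtain ⟨x₀, hx₀, hmin⟩ := hZc.exists_isMinOn hZe hcont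
      exact ⟨|G (refIdx m) x₀ - 1|, abs_pos.2 (hZne x₀ hx₀), fun x hx => hmin hx⟩
  -- ### the plateau
  set δ : ℝ := min (μ ^ 2 / 2) (r₀ ^ 4 / 16) with hδ
  have hδpos : 0 < δ := by positivity
  have hδμ : δ < μ ^ 2 := lt_of_le_of_lt (min_le_left _ _) (by nlinarith)
  have hδr : δ ≤ r₀ ^ 4 / 16 := min_le_right _ _
  obtain ⟨ψ, e, he, he2, hψs, hψ01, hψone, hψzero, hψδ, hψη⟩ :=
    exists_sqProfile (lt_min hη₀ one_pos) hδpos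
  have hψd : Differentiable ℝ ψ := hψs.differentiable (by simp)
  have hψη₀ : ∀ t, |t * deriv ψ t| ≤ η₀ := fun t => (hψη t).trans (min_le_left _ _)
  have hψ1 : ∀ t, |t * deriv ψ t| ≤ 1 := fun t => (hψη t).trans (min_le_right _ _)
  have he_small : e < r₀ ^ 2 / 4 := by
    have h1 : e ^ 2 < (r₀ ^ 2 / 4) ^ 2 := by nlinarith
    exact (pow_lt_pow_iff_left₀ he.le (by positivity) two_ne_zero).1 h1
  -- ### the radial taper and the cutoff
  set θ : X → ℝ := (tubeSet Ot u v (10 * r₀)).piecewise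
    (fun x => seamTaper r₀ (pCo m (u x) (v x))) (fun _ => 1) with hθ
  have hθin : ∀ x ∈ tubeSet Ot u v (10 * r₀), θ x = seamTaper r₀ (pCo m (u x) (v x)) :=
    fun x hx => piecewise_eq_of_mem _ _ _ hx
  have hθout : ∀ x ∉ tubeSet Ot u v (10 * r₀), θ x = 1 := fun x hx => piecewise_eq_of_notMem _ _ _ hx
  have hθ01 : ∀ x, 0 ≤ θ x ∧ θ x ≤ 1 := fun x => by
    by_cases hx : x ∈ tubeSet Ot u v (10 * r₀)
    · rw [hθin x hx]; exact ⟨Real.smoothTransition.nonneg _, Real.smoothTransition.le_one _⟩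
    · rw [hθout x hx]; exact ⟨zero_le_one, le_rfl⟩
  set χ : X → ℝ := N.indicator fun x => θ x * ψ (G (refIdx m) x - 1) with hχ
  have hχin : ∀ x ∈ N, χ x = θ x * ψ (G (refIdx m) x - 1) := fun x hx => indicator_of_mem hx _
  have hχout : ∀ x ∉ N, χ x = 0 := fun x hx => indicator_of_notMem hx _
  have hχ01 : ∀ x, 0 ≤ χ x ∧ χ x ≤ 1 := fun x => by
    by_cases hx : x ∈ N
    · rw [hχin x hx]
      obtain ⟨h0, h1⟩ := hθ01 x
      obtain ⟨h0', h1'⟩ := hψ01 (G (refIdx m) x - 1)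
      exact ⟨mul_nonneg h0 h0', by nlinarith⟩
    · rw [hχout x hx]; exact ⟨le_rfl, zero_le_one⟩
  -- `χ` vanishes near points where `σ² > δ`
  have hkill : ∀ x, δ < (G (refIdx m) x - 1) ^ 2 → χ =ᶠ[𝓝 x] fun _ => 0 := by
    intro x hx
    have hopen : IsOpen {y | δ < (G (refIdx m) y - 1) ^ 2} :=
      isOpen_lt continuous_const (((hGs _).continuous.sub continuous_const).pow 2)
    filter_upwards [hopen.mem_nhds hx] with y hy
    by_cases hyN : y ∈ N
    · rw [hχin y hyN, hψzero _ (le_of_lt hy), mul_zero]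
    · exact hχout y hyN
  -- `θ = 1` near the points of `N` off the tube
  have hθone : ∀ x ∈ N, x ∉ tubeSet Ot u v (10 * r₀) → ∀ᶠ y in 𝓝 x, θ y = 1 := by
    intro x hxN hx10
    by_cases hcl : x ∈ closure (tubeSet Ot u v (10 * r₀))
    · obtain ⟨hxOt, hp, hq⟩ := hA1 x hxN hcl
      have h100 : (10 * r₀) ^ 2 ≤ u x ^ 2 + v x ^ 2 := by
        by_contra h; exact hx10 ⟨hxOt, not_le.1 h⟩
      have h6 : 6 * r₀ < pCo m (u x) (v x) := six_lt_pCo hr₀ hp hq (by nlinarith)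
      filter_upwards [(isOpen_lt continuous_const hpc).mem_nhds h6] with y hy
      by_cases hy10 : y ∈ tubeSet Ot u v (10 * r₀)
      · rw [hθin y hy10]
        exact Real.smoothTransition.one_of_one_le
          (by rw [le_sub_iff_add_le, le_div_iff₀ hr₀]; have : 6 * r₀ < pCo m (u y) (v y) := hy; linarith)
      · exact hθout y hy10
    · filter_upwards [isClosed_closure.isOpen_compl.mem_nhds hcl] with y hy
      exact hθout y (fun h => hy (subset_closure h))
  have hθsmooth : ∀ x ∈ N, ContMDiffAt (𝓡 4) 𝓘(ℝ, ℝ) ∞ θ x := by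
    intro x hxN
    by_cases hx10 : x ∈ tubeSet Ot u v (10 * r₀)
    · have heq : θ =ᶠ[𝓝 x] fun y => seamTaper r₀ (pCo m (u y) (v y)) := by
        filter_upwards [(hTo _).mem_nhds hx10] with y hy using hθin y hy
      refine ContMDiffAt.congr_of_eventuallyEq ?_ heq
      have h1 := contMDiff_pCo_comp m hfr.contMDiff_u hfr.contMDiff_v
      have h2 : ContDiff ℝ ∞ fun t : ℝ => Real.smoothTransition (t / r₀ - 5) :=
        Real.smoothTransition.contDiff.comp ((contDiff_id.div_const r₀).sub contDiff_const)
      exact ((contMDiff_iff_contDiff.2 h2).comp h1).contMDiffAt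
    · exact contMDiffAt_const.congr_of_eventuallyEq (hθone x hxN hx10)
  -- `χ` vanishes near every point off `N`
  have hχnear : ∀ x ∉ N, χ =ᶠ[𝓝 x] fun _ => 0 := by
    intro x hxN
    by_cases hcl : x ∈ closure N
    · by_cases hx10 : x ∈ tubeSet Ot u v (10 * r₀)
      · obtain ⟨hp, hq⟩ := hA3 x hcl hx10
        have hxOt : x ∈ Ot := hx10.1
        have hnot : ¬ (r₀ < pCo m (u x) (v x) ∧ |qCo m (u x) (v x)| < r₀ / 2) := fun h =>
          hxN ((hP3 x hx10).2 h)
        by_cases hpx : pCo m (u x) (v x) ≤ r₀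
        · -- near `x` the taper vanishes
          have h16 : u x ^ 2 + v x ^ 2 < (4 * r₀) ^ 2 := normSq_lt_of_pCo_le hr₀ (by linarith) hpx hq
          filter_upwards [(hTo (4 * r₀)).mem_nhds (show x ∈ tubeSet Ot u v (4 * r₀) from ⟨hxOt, h16⟩)]
            with y hy
          have hy10 : y ∈ tubeSet Ot u v (10 * r₀) := h4_10 hy
          have hpy : pCo m (u y) (v y) < 4 * r₀ := hp_lt (by linarith) hy
          have hθ0 : θ y = 0 := by
            rw [hθin y hy10]
            exact Real.smoothTransition.zero_of_nonpos (by rw [sub_nonpos, div_le_iff₀ hr₀]; linarith)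
          by_cases hyN : y ∈ N
          · rw [hχin y hyN, hθ0, zero_mul]
          · exact hχout y hyN
        · -- `|q| ≥ r₀ / 2`, so `σ² ≥ r₀⁴ > δ`
          have hqx : r₀ / 2 ≤ |qCo m (u x) (v x)| := by
            by_contra h; exact hnot ⟨not_le.1 hpx, not_le.1 h⟩
          apply hkill
          have hσ := hσ20 x (h10_20 hx10)
          have hp0 : 0 < pCo m (u x) (v x) := by linarith
          have h1 : r₀ ^ 2 ≤ |G (refIdx m) x - 1| := by
            rw [hσ, abs_mul, abs_mul, abs_neg, abs_two, abs_of_pos hp0]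
            nlinarith
          have h2 : (r₀ ^ 2) ^ 2 ≤ (G (refIdx m) x - 1) ^ 2 := by
            rw [← sq_abs (G (refIdx m) x - 1)]; exact pow_le_pow_left₀ (by positivity) h1 2
          have h3 : δ < (r₀ ^ 2) ^ 2 := by nlinarith
          exact lt_of_lt_of_le h3 h2
      · apply hkill
        have h1 := hμle x ⟨hcl, hxN, hx10⟩
        have h2 : μ ^ 2 ≤ (G (refIdx m) x - 1) ^ 2 := by
          rw [← sq_abs (G (refIdx m) x - 1)]; exact pow_le_pow_left₀ hμ.le h1 2
        exact lt_of_lt_of_le hδμ h2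
    · filter_upwards [isClosed_closure.isOpen_compl.mem_nhds hcl] with y hy
      exact hχout y (fun h => hy (subset_closure h))
  have hχs : ContMDiff (𝓡 4) 𝓘(ℝ, ℝ) ∞ χ := by
    intro x
    by_cases hxN : x ∈ N
    · have heq : χ =ᶠ[𝓝 x] fun y => θ y * ψ (G (refIdx m) y - 1) := by
        filter_upwards [hNo.mem_nhds hxN] with y hy using hχin y hy
      refine ContMDiffAt.congr_of_eventuallyEq ?_ heq
      exact (hθsmooth x hxN).mul
        (((contMDiff_iff_contDiff.2 hψs).comp ((hGs _).sub contMDiff_const)).contMDiffAt)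
    · exact contMDiffAt_const.congr_of_eventuallyEq (hχnear x hxN)
  -- ### the clauses
  refine ⟨N, χ, e, hNo, he, hP2, hP3, hP4, hP5, hP5n, hP6, hP7, hP8, hχs, hχ01, hχnear, ?_, ?_, ?_, ?_⟩
  · -- the band: `χ = seamTaper r₀ (p)` on the thin box
    intro x hx10 hp hσe
    have hσ := hσ20 x (h10_20 hx10)
    have hp0 : 0 < pCo m (u x) (v x) := hr₀.trans hp
    have hq : |qCo m (u x) (v x)| < r₀ / 2 := by
      rw [hσ, abs_mul, abs_mul, abs_neg, abs_two, abs_of_pos hp0] at hσe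
      by_contra h
      have h' : r₀ / 2 ≤ |qCo m (u x) (v x)| := not_lt.1 h
      nlinarith
    have hxN : x ∈ N := (hP3 x hx10).2 ⟨hp, hq⟩
    refine ⟨hxN, ?_⟩
    rw [hχin x hxN, hθin x hx10, hψone _ hσe, mul_one]
  · -- `χ = 0` on `T(4 r₀)`
    intro x hx4
    by_cases hxN : x ∈ N
    · have hx10 := h4_10 hx4
      have hpx : pCo m (u x) (v x) < 4 * r₀ := hp_lt (by linarith) hx4
      rw [hχin x hxN, hθin x hx10]
      rw [show seamTaper r₀ (pCo m (u x) (v x)) = 0 from Real.smoothTransition.zero_of_nonpos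
        (by rw [sub_nonpos, div_le_iff₀ hr₀]; linarith), zero_mul]
    · exact hχout x hxN
  · -- `χ = 1` along the seam beyond `T(9 r₀)`
    intro x hxN hx9 hσe
    rw [hχin x hxN, hψone _ hσe, mul_one]
    by_cases hx10 : x ∈ tubeSet Ot u v (10 * r₀)
    · obtain ⟨hp, hq⟩ := (hP3 x hx10).1 hxN
      have h81 : (9 * r₀) ^ 2 ≤ u x ^ 2 + v x ^ 2 := by
        by_contra h; exact hx9 ⟨hx10.1, not_le.1 h⟩
      have h6 := six_lt_pCo hr₀ hp hq h81
      rw [hθin x hx10]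
      exact Real.smoothTransition.one_of_one_le
        (by rw [le_sub_iff_add_le, le_div_iff₀ hr₀]; linarith)
    · exact hθout x hx10
  · -- no critical points on `N`
    intro x hxN f hf hfeq
    by_cases hx10 : x ∈ tubeSet Ot u v (10 * r₀)
    · obtain ⟨hp, hq⟩ := (hP3 x hx10).1 hxN
      refine modified_regular_tube hTS hρF m hψd hψ01 hψ1 hψδ hr₀ hδr hf hx10.1 ?_ hp hq
      filter_upwards [hfeq, hNo.mem_nhds hxN, (hTo _).mem_nhds hx10] with y hy hyN hy10
      rw [hy, hχin y hyN, hθin y hy10, hσ20 y (h10_20 hy10), hGn20 y (h10_20 hy10)]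
    · refine hLM ψ hψd hψ01 hψη₀ x hxN hx10 f hf ?_
      filter_upwards [hfeq, hNo.mem_nhds hxN, hθone x hxN hx10] with y hy hyN hθy
      rw [hy, hχin y hyN, hθy, one_mul]

/-! ## The toolkit (a registered helper stub) -/

/-- **The seam-cutoff toolkit** (registered helper stub of the line, proved in this file): the
construction `exists_seamCutoff` of the seam cutoff `χ m` with all its clauses. -/
def SeamFormCutoffToolkit : Prop :=
  ∀ (X : Type) [TopologicalSpace X] [T2Space X] [ChartedSpace (EuclideanSpace ℝ (Fin 4)) X]
    [IsManifold (𝓡 4) ∞ X] [CompactSpace X]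
    (S : Fin 3 → Set X) (u v : X → ℝ) (ρ : X → X) (U O : Set X) (c : Fin 3 → ℕ → ℕ),
    TriNormalForm S 0 1 2 u v ρ U O c → ∀ (G : Fin 3 → X → ℝ),
    (∀ j, ContMDiff (𝓡 4) 𝓘(ℝ, ℝ) ∞ (G j)) →
    (∀ j, ∀ p ∈ S j, p ∉ interior (S j) → G j p = 1) →
    (∀ j, ∀ p ∈ interior (S j), G j p < 1) →
    (∀ j, ∀ p ∈ S j, p ∉ interior (S j) → p ∉ (⋂ l, S l) → ¬ IsMCriticalPt (𝓡 4) (G j) p) →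
    (∀ j, ∀ p ∈ S j, p ∉ (⋂ l, S l) →
      ∃ D : HalfSliceChart (𝓡 4) (S j), p ∈ D.Θ.source ∧ ∀ q ∈ D.Θ.source, q ∉ ⋂ l, S l) →
    ∀ (Ot : Set X) (rt : ℝ) (tp : X → ℝ → ℝ → X),
    TubeStructure (S 0) (⋂ l, S l) u v ρ O Ot rt tp → ∀ (r₀ : ℝ), 0 < r₀ → 20 * r₀ ≤ rt →
    (∀ j, ∀ x ∈ tubeSet Ot u v (20 * r₀), G j x = unitForm j (u x) (v x)) →
    ∀ (m : Fin 3) (Um : Set X), IsOpen Um →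
    (∀ x ∈ S (refIdx m) ∩ S (normIdx m), x ∉ tubeSet Ot u v (9 * r₀) → x ∈ Um) →
    ∃ (N : Set X) (χ : X → ℝ) (e : ℝ), IsOpen N ∧ 0 < e ∧
      (∀ x ∈ S (refIdx m) ∩ S (normIdx m), x ∉ tubeSet Ot u v (2 * r₀) → x ∈ N) ∧
      (∀ x ∈ tubeSet Ot u v (10 * r₀),
        x ∈ N ↔ r₀ < pCo m (u x) (v x) ∧ |qCo m (u x) (v x)| < r₀ / 2) ∧
      N ⊆ tubeSet Ot u v (10 * r₀) ∪ Um ∧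
      (∀ x ∈ N, ¬ IsMCriticalPt (𝓡 4) (G (refIdx m)) x) ∧
      (∀ x ∈ N, ¬ IsMCriticalPt (𝓡 4) (G (normIdx m)) x) ∧
      (∀ x ∈ N, G (refIdx m) x = 1 ↔ x ∈ S (refIdx m) ∩ S (normIdx m)) ∧
      (∀ x ∈ N, x ∈ S (refIdx m) ↔ G (refIdx m) x ≤ 1) ∧
      (∀ x ∈ N, x ∈ S (normIdx m) ↔ 1 ≤ G (refIdx m) x) ∧
      ContMDiff (𝓡 4) 𝓘(ℝ, ℝ) ∞ χ ∧ (∀ x, 0 ≤ χ x ∧ χ x ≤ 1) ∧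
      (∀ x ∉ N, χ =ᶠ[𝓝 x] fun _ => 0) ∧
      (∀ x ∈ tubeSet Ot u v (10 * r₀), r₀ < pCo m (u x) (v x) → |G (refIdx m) x - 1| < e →
        x ∈ N ∧ χ x = seamTaper r₀ (pCo m (u x) (v x))) ∧
      (∀ x ∈ tubeSet Ot u v (4 * r₀), χ x = 0) ∧
      (∀ x ∈ N, x ∉ tubeSet Ot u v (9 * r₀) → |G (refIdx m) x - 1| < e → χ x = 1) ∧
      (∀ x ∈ N, ∀ f : X → ℝ, ContMDiff (𝓡 4) 𝓘(ℝ, ℝ) ∞ f →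
        (f =ᶠ[𝓝 x] fun y => G (normIdx m) y + χ y * (1 - (G (refIdx m) y - 1) - G (normIdx m) y)) →
        ¬ IsMCriticalPt (𝓡 4) f x)

/-- **Registered helper stub `stub_seamFormCutoffToolkit`** of line `lp-by-sphere-system-surgery`
(the seam cutoff of the seam normalisation `stub_seamForm`). [cite: AbramsGayKirby2018, proof of Thm. 5] -/
theorem stub_seamFormCutoffToolkit : SeamFormCutoffToolkit :=
  fun _ _ _ _ _ _ _ _ _ _ _ _ _ hT _ hGs hG1 hG2 hG3 hhalf _ _ _ hTS _ hr₀ hrt hunit m _ hUmo hUm =>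
    exists_seamCutoff hT hGs hG1 hG2 hG3 hhalf hTS hr₀ hrt hunit m hUmo hUm

end Summit.SmoothPoincare4.SmoothPoincare4.Cruxes.AgkCor6Sufficiency.LpBySphereSystemSurgery

end
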